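import Summits.CriticalPhenomena.SAWScalingLimit.Theorems.SAWDevelopingMapHexConjectureKPGlueB
import Summits.CriticalPhenomena.SAWScalingLimit.Theorems.SAWDevelopingMapHexConjectureKPCountBAux
import HarnessLib

/-!
# Crux `HexConjecture` (stmt-CriticalPhenomena-0808), line `root-locality-replaces-loewner`:
Krachun–Panagiotis Lemma 3.3, the counting step (registered stub `stub_kp_countB`)

Landing target:
`Summits/CriticalPhenomena/SAWScalingLimit/Theorems/SAWDevelopingMapHexConjectureKPCountB.lean`
(`--supports stmt-CriticalPhenomena-0808`).

[KP, proof of Lemma 3.3]: the glued walks `γ = γ₁ ∘ γ₂ ∘ γ₃` of construction (b) (`stub_kp_glueB`: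
`γ₁ ∈ D(Tria_{2k+1})` with few renewal times, `k ∈ [T, 2T)`; `γ₂` a right exit of the trapezoid
`Trap_{2i+1,x}` with few renewal times, `i ∈ [4T, 5T)`; `γ₃` a right walk of the triangle hanging
from the exit `y` of `γ₂`) are U-walks of the strip `S_{32T+1,32T+1}` ending on the real axis at an
offset `d ∈ [T, 21T]`, of length `ℓ(γ₁) + ℓ(γ₂) + ℓ(γ₃)`, and "arguing as in the proof of Lemma 3.2
… there are at most `max_k M_k` choices for `γ₁` and at most `max_i M_i` choices for `γ₂`": every
glued walk has at most `M₁ M₂` pre-images.  Hence the weighted count of the 5-tuples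
`t = (k, γ₁, i, γ₂, γ₃)` — the left-hand side of the registered inequality, with
`triDr r = Σ_{γ₃} x_c^{ℓ(γ₃)}` — is at most `M₁ M₂ ≤ (1 + M₁)(1 + M₂)` times the coded floor-arch mass of
the window `[T, 21T]`.

The 5-tuples form a nested `Finset.sigma` (components `t.1 = k`, `t.2.1 = γ₁`, `t.2.2.1 = i`,
`t.2.2.2.1 = γ₂`, `t.2.2.2.2 = γ₃`); the gluing map is
`γ₁ ++ (φ γ₂).drop 2 ++ (φ ψ γ₃).drop 2` with `φ = attach x₀ x₁`, `ψ = attach p₀ p₁` read off the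
final darts of `γ₁`, `γ₂` (no new definitions: both are written out).
* `cb_glue` — the conclusions of `stub_kp_glueB` for a tuple (`N = 32T`: `2k ≤ i`,
  `6k + 4i + 4 ≤ 32T + 1`, `d ∈ [i+1-k, 3k+3i+1] ⊆ [T, 21T]`);
* `cb_fibre_le` — the multiplicity bound `#Φ⁻¹(γ) ≤ M₁ M₂` (`kpCountB_card_le_mul` of the helper
  file fed with the pre-image facts `kpCountB_cut₁/cut₂/ren₁`, `kpCount_crossCount_eq_one`: the
  pre-image is determined by `(k, i)`, the valid `k`'s are renewal times of the `γ₁` of the largest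
  one, and, `k` fixed, the valid `i`'s are renewal times of the `γ₂` of the largest one;
  `#renewal times ≤ renCap ≤ M`);
* `cb_sum_eq` — the left-hand side is `Σ_t x_c^{ℓ(Φ t)}`; `stub_kp_countB` — the weighted counting
  `kpCount_sum_le_mul_sum` (the multivalued map principle of `…KPCountA.lean`) over the (disjoint,
  `cb_disjoint`) union of the coded finsets.
-/

noncomputable section

open scoped Classical
open Finset
open Literature.Probability.RandomPlanarGeometry.SAW Literature.Probability.RandomPlanarGeometry.SAW.HV

namespace Summit.CriticalPhenomena.SAWScalingLimit.Theorems.HexConjecture.RootLocality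

/-! ### Construction (b) on a 5-tuple -/

/-- A right exit of the clipped triangle `C(i, h) ⊆ T_i` is a right walk of `T_i`.
[cite: KrachunPanagiotis2026, §3.2 (Trap_{2i+1,x} ⊆ Tria_{2i+1,x})] -/
theorem rightWalks_of_clip {i h : ℕ} {P : List HV} (hP : P ∈ midWalks (clipV i h))
    (hR : IsRightDart i (finalDart P)) : P ∈ rightWalks i := by
  rw [rightWalks, mem_filter]
  exact ⟨midWalks_mono (clipV_subset i h) hP, hR⟩

/-- **Construction (b) applied to a 5-tuple** (`stub_kp_glueB` with `N = 32T`, the placements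
`φ = attach x₀ x₁`, `ψ = attach p₀ p₁` read off the final darts of `γ₁`, `γ₂`): the glued list is
a self-avoiding mid-edge walk of `S_{32T+1,32T+1}` leaving through the floor at an offset
`d ∈ [T, 21T]`, its length is `ℓ(γ₁) + ℓ(γ₂) + ℓ(γ₃)`, the last two placed pieces live at slanted
levels `≥ k + 1` and the placed third piece at slanted levels `≥ i + 1` of the second frame.
[cite: KrachunPanagiotis2026, proof of Lemma 3.3 ("we obtain a walk γ contributing to Σ_{k=T}^{21T} G_k")] -/
theorem cb_glue {T k i : ℕ} {P₁ P₂ P₃ : List HV} {φ ψ : hvGraph ≃g hvGraph}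
    (hk : T ≤ k ∧ k < 2 * T) (hi : 4 * T ≤ i ∧ i < 5 * T) (hP₁ : P₁ ∈ rightWalks k)
    (hP₂ : P₂ ∈ midWalks (clipV i (htOf P₁))) (hR₂ : IsRightDart i (finalDart P₂))
    (hP₃ : P₃ ∈ rightWalks ((((htOf P₁ : ℕ) : ℤ) - (finalDart P₂).1.1).toNat))
    (hφ : φ = attach (finalDart P₁).1.1 (finalDart P₁).1.2.1)
    (hψ : ψ = attach (finalDart P₂).1.1 (finalDart P₂).1.2.1) :
    P₁ ++ (P₂.map φ).drop 2 ++ ((P₃.map ψ).map φ).drop 2 ∈ midWalks (stripV (32 * T + 1) (32 * T + 1)) ∧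
      (∃ d : ℤ, (T : ℤ) ≤ d ∧ d ≤ 21 * T ∧
        finalDart (P₁ ++ (P₂.map φ).drop 2 ++ ((P₃.map ψ).map φ).drop 2) =
          ((d, 0, false), (d, -1, true))) ∧
      mwLen (P₁ ++ (P₂.map φ).drop 2 ++ ((P₃.map ψ).map φ).drop 2) = mwLen P₁ + mwLen P₂ + mwLen P₃ ∧
      (∀ v ∈ (P₂.map φ).drop 2 ++ ((P₃.map ψ).map φ).drop 2, (k : ℤ) + 1 ≤ slev v) ∧
      (∀ v ∈ (P₃.map ψ).drop 2, (i : ℤ) + 1 ≤ slev v) := by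
  subst hφ hψ
  obtain ⟨-, -, -, hx₁, -⟩ := rightWalks_crossings hP₁
  have hh : ((htOf P₁ : ℕ) : ℤ) = (finalDart P₁).1.2.1 := Int.toNat_of_nonneg hx₁
  rw [hh] at hP₃
  obtain ⟨h1, h2, h3, h4, h5, h6, h7⟩ := stub_kp_glueB k i (32 * T) P₁ P₂ P₃ _ _ _ _ hP₁
    (kpCount_finalDart_eq hP₁) (by omega) hP₂ (kpCount_finalDart_eq (rightWalks_of_clip hP₂ hR₂)) hR₂
    hP₃ (by omega)
  refine ⟨h1, ⟨_, ?_, ?_, h2⟩, h3, h4, h5⟩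
  · have hi₁ := hi.1
    have hk₂ := hk.2
    omega
  · have hi₂ := hi.2
    have hk₂ := hk.2
    omega

/-! ### The multiplicity bound -/

/-- **The multiplicity of the gluing map is at most `M₁ M₂`**: given a glued walk `G`, a pre-image
5-tuple is determined by its scales `(k, i)` (`kpCountB_cut₁`, `kpCountB_cut₂`); the valid `k`'s are
renewal times of the first piece of the pre-image with the largest `k` (`kpCountB_ren₁`), at most
`renewals ≤ renCap k ≤ M₁` of them; `k` fixed, the valid `i`'s are renewal times of the second piece
of the pre-image with the largest `i` (`kpCount_crossCount_eq_one` on `σ`), at most `renCap i ≤ M₂`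
of them.
[cite: KrachunPanagiotis2026, proof of Lemma 3.3 ("at most max_k M_k choices for γ₁, and at most max_i M_i choices for γ₂")] -/
theorem cb_fibre_le {T : ℕ} (hT : 1 ≤ T) {M₁ M₂ : ℝ}
    (hM₁ : ∀ k : ℕ, T ≤ k → k < 2 * T → renCap k ≤ M₁)
    (hM₂ : ∀ i : ℕ, 4 * T ≤ i → i < 5 * T → renCap i ≤ M₂) (G : List HV) :
    (((((Finset.Ico T (2 * T)).sigma fun k =>
        ((rightWalks k).filter (fun P => (renewals k P : ℝ) ≤ renCap k ∧ ¬ GoodHt T (htOf P))).sigma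
          fun P₁ => (Finset.Ico (4 * T) (5 * T)).sigma fun i =>
            ((midWalks (clipV i (htOf P₁))).filter
              (fun P => IsRightDart i (finalDart P) ∧ (renewals i P : ℝ) ≤ renCap i)).sigma fun P₂ =>
                rightWalks ((((htOf P₁ : ℕ) : ℤ) - (finalDart P₂).1.1).toNat)).filter fun t =>
        t.2.1 ++ (t.2.2.2.1.map (attach (finalDart t.2.1).1.1 (finalDart t.2.1).1.2.1)).drop 2 ++
          ((t.2.2.2.2.map (attach (finalDart t.2.2.2.1).1.1 (finalDart t.2.2.2.1).1.2.1)).map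
            (attach (finalDart t.2.1).1.1 (finalDart t.2.1).1.2.1)).drop 2 = G).card : ℕ) : ℝ) ≤
      M₁ * M₂ := by
  have h0₁ : 0 ≤ M₁ := (kpCount_renCap_nonneg T).trans (hM₁ T le_rfl (by omega))
  have h0₂ : 0 ≤ M₂ := (kpCount_renCap_nonneg (4 * T)).trans (hM₂ (4 * T) le_rfl (by omega))
  refine kpCountB_card_le_mul _ (fun t => t.1) (fun t => t.2.2.1)
    (fun t => (range (t.1 + 1)).filter fun j : ℕ => crossCount (j : ℤ) t.2.1 = 1)
    (fun t => (range (t.2.2.1 + 1)).filter fun j : ℕ => crossCount (j : ℤ) t.2.2.2.1 = 1)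
    h0₁ h0₂ ?_ ?_ ?_ ?_ ?_
  · -- the valid first scales are renewal times of the first piece
    rintro ⟨k, P₁, i, P₂, P₃⟩ ht ⟨k', P₁', i', P₂', P₃'⟩ ht' hk
    simp only [mem_filter, mem_sigma, mem_Ico] at ht ht'
    obtain ⟨⟨-, ⟨hP₁, -, -⟩, -, ⟨hP₂, -, -⟩, -⟩, hG⟩ := ht
    obtain ⟨⟨hk', ⟨hP₁', -, -⟩, hi', ⟨hP₂', hR₂', -⟩, hP₃'⟩, hG'⟩ := ht'
    obtain ⟨-, -, -, hs', -⟩ := cb_glue hk' hi' hP₁' hP₂' hR₂' hP₃' rfl rfl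
    dsimp only at hk ⊢
    exact mem_filter.2 ⟨mem_range.2 (Nat.lt_succ_of_le hk),
      kpCountB_ren₁ (A := fun P => attach (finalDart P).1.1 (finalDart P).1.2.1) hP₁ hP₁' hP₂ hP₂' hs'
        (hG.trans hG'.symm) hk⟩
  · -- their number is at most `renCap k ≤ M₁`
    rintro ⟨k, P₁, i, P₂, P₃⟩ ht
    simp only [mem_filter, mem_sigma, mem_Ico] at ht
    obtain ⟨⟨hk, ⟨-, hr₁, -⟩, -⟩, -⟩ := ht
    exact hr₁.trans (hM₁ k hk.1 hk.2)
  · -- first piece fixed, the valid second scales are renewal times of the second piece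
    rintro ⟨k, P₁, i, P₂, P₃⟩ ht ⟨k', P₁', i', P₂', P₃'⟩ ht' hk hi
    simp only [mem_filter, mem_sigma, mem_Ico] at ht ht'
    obtain ⟨⟨-, ⟨hP₁, -, -⟩, -, ⟨hP₂, hR₂, -⟩, -⟩, hG⟩ := ht
    obtain ⟨⟨hk', ⟨hP₁', -, -⟩, hi', ⟨hP₂', hR₂', -⟩, hP₃'⟩, hG'⟩ := ht'
    obtain ⟨-, -, -, -, hs'⟩ := cb_glue hk' hi' hP₁' hP₂' hR₂' hP₃' rfl rfl
    dsimp only at hk hi ⊢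
    subst hk
    have hcut := kpCountB_cut₁ (A := fun P => attach (finalDart P).1.1 (finalDart P).1.2.1) hP₁ hP₁'
      hP₂ hP₂' (hG.trans hG'.symm)
    exact mem_filter.2 ⟨mem_range.2 (Nat.lt_succ_of_le hi),
      kpCount_crossCount_eq_one (rightWalks_of_clip hP₂ hR₂) (rightWalks_of_clip hP₂' hR₂') hs' hcut.2 hi⟩
  · -- their number is at most `renCap i ≤ M₂`
    rintro ⟨k, P₁, i, P₂, P₃⟩ ht
    simp only [mem_filter, mem_sigma, mem_Ico] at ht
    obtain ⟨⟨-, -, hi, ⟨-, -, hr₂⟩, -⟩, -⟩ := ht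
    exact hr₂.trans (hM₂ i hi.1 hi.2)
  · -- the scales determine the pre-image
    rintro ⟨k, P₁, i, P₂, P₃⟩ ht ⟨k', P₁', i', P₂', P₃'⟩ ht' hk hi
    simp only [mem_filter, mem_sigma, mem_Ico] at ht ht'
    obtain ⟨⟨-, ⟨hP₁, -, -⟩, -, ⟨hP₂, hR₂, -⟩, hP₃⟩, hG⟩ := ht
    obtain ⟨⟨-, ⟨hP₁', -, -⟩, -, ⟨hP₂', hR₂', -⟩, hP₃'⟩, hG'⟩ := ht'
    dsimp only at hk hi ⊢
    subst hk hi
    obtain ⟨e₁, e⟩ := kpCountB_cut₁ (A := fun P => attach (finalDart P).1.1 (finalDart P).1.2.1) hP₁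
      hP₁' hP₂ hP₂' (hG.trans hG'.symm)
    obtain ⟨e₂, e₃⟩ := kpCountB_cut₂ (A := fun P => attach (finalDart P).1.1 (finalDart P).1.2.1)
      (rightWalks_of_clip hP₂ hR₂) (rightWalks_of_clip hP₂' hR₂')
      hP₃ hP₃' e
    subst e₁ e₂ e₃
    rfl

/-! ### The registered stub -/

/-- **The left-hand side of Lemma 3.3 as a sum over 5-tuples** of the weight of the glued walk
(`x_c^{ℓ₁} x_c^{ℓ₂} x_c^{ℓ₃} = x_c^{ℓ(γ₁ ∘ γ₂ ∘ γ₃)}`, `triDr r = Σ_{γ₃ ∈ rightWalks r} x_c^{ℓ(γ₃)}`).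
[cite: KrachunPanagiotis2026, proof of Lemma 3.3 ("the partition function of the constructed walks")] -/
theorem cb_sum_eq (T : ℕ) :
    ∑ t ∈ (Finset.Ico T (2 * T)).sigma fun k =>
        ((rightWalks k).filter (fun P => (renewals k P : ℝ) ≤ renCap k ∧ ¬ GoodHt T (htOf P))).sigma
          fun P₁ => (Finset.Ico (4 * T) (5 * T)).sigma fun i =>
            ((midWalks (clipV i (htOf P₁))).filter
              (fun P => IsRightDart i (finalDart P) ∧ (renewals i P : ℝ) ≤ renCap i)).sigma fun P₂ =>
                rightWalks ((((htOf P₁ : ℕ) : ℤ) - (finalDart P₂).1.1).toNat),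
      hexCriticalFugacity ^ mwLen (t.2.1 ++
        (t.2.2.2.1.map (attach (finalDart t.2.1).1.1 (finalDart t.2.1).1.2.1)).drop 2 ++
        ((t.2.2.2.2.map (attach (finalDart t.2.2.2.1).1.1 (finalDart t.2.2.2.1).1.2.1)).map
          (attach (finalDart t.2.1).1.1 (finalDart t.2.1).1.2.1)).drop 2) =
    ∑ k ∈ Finset.Ico T (2 * T), ∑ P₁ ∈ (rightWalks k).filter (fun P => (renewals k P : ℝ) ≤ renCap k ∧ ¬ GoodHt T (htOf P)), Literature.Probability.RandomPlanarGeometry.SAW.hexCriticalFugacity ^ Literature.Probability.RandomPlanarGeometry.SAW.HV.mwLen P₁ * ∑ i ∈ Finset.Ico (4 * T) (5 * T), ∑ P₂ ∈ (Literature.Probability.RandomPlanarGeometry.SAW.HV.midWalks (clipV i (htOf P₁))).filter (fun P => Literature.Probability.RandomPlanarGeometry.SAW.HV.IsRightDart i (Literature.Probability.RandomPlanarGeometry.SAW.HV.finalDart P) ∧ (renewals i P : ℝ) ≤ renCap i), Literature.Probability.RandomPlanarGeometry.SAW.hexCriticalFugacity ^ Literature.Probability.RandomPlanarGeometry.SAW.HV.mwLen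 P₂ * Literature.Probability.RandomPlanarGeometry.SAW.HV.triDr (((htOf P₁ : ℕ) : ℤ) - (Literature.Probability.RandomPlanarGeometry.SAW.HV.finalDart P₂).1.1).toNat := by
  refine (sum_congr rfl (g := fun t => hexCriticalFugacity ^ mwLen t.2.1 *
    (hexCriticalFugacity ^ mwLen t.2.2.2.1 * hexCriticalFugacity ^ mwLen t.2.2.2.2)) ?_).trans ?_
  · rintro ⟨k, P₁, i, P₂, P₃⟩ ht
    simp only [mem_sigma, mem_filter, mem_Ico] at ht
    obtain ⟨hk, ⟨hP₁, -, -⟩, hi, ⟨hP₂, hR₂, -⟩, hP₃⟩ := ht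
    dsimp only
    rw [(cb_glue hk hi hP₁ hP₂ hR₂ hP₃ rfl rfl).2.2.1, pow_add, pow_add, mul_assoc]
  · simp only [sum_sigma, mul_sum, triDr_eq_sum_rightWalks]

/-- The coded floor-arch finsets for distinct offsets are disjoint. [folklore] -/
theorem cb_disjoint (T : ℕ) :
    (↑(Finset.Icc (T : ℤ) (21 * T)) : Set ℤ).PairwiseDisjoint fun d =>
      (midWalks (stripV (32 * T + 1) (32 * T + 1))).filter (fun P =>
        finalDart P = ((d, 0, false), (d, -1, true)) ∨ finalDart P = ((d, -1, true), (d, 0, false))) := by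
  intro d _ d' _ hne
  change Disjoint _ _
  rw [disjoint_left]
  intro P hP hP'
  rw [mem_filter] at hP hP'
  apply hne
  have e1 : (finalDart P).1.1 = d := by rcases hP.2 with h | h <;> rw [h]
  have e2 : (finalDart P).1.1 = d' := by rcases hP'.2 with h | h <;> rw [h]
  rw [← e1, e2]

/-- **Registered sub-goal `stub_kp_countB`** (crux item stmt-CriticalPhenomena-0808, line
`root-locality-replaces-loewner`): the counting step of Krachun–Panagiotis's Lemma 3.3.  The
weighted count of the 5-tuples `(k, γ₁, i, γ₂, γ₃)` of construction (b) (`k ∈ [T, 2T)`, `γ₁` a right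
walk of `T_k` with at most `M_k` renewal times and a bad exit height, `i ∈ [4T, 5T)`, `γ₂` a right exit
of the trapezoid with at most `M_i` renewal times, `γ₃` a right walk of the hanging triangle `T_r`) is
at most `(1 + M₁)(1 + M₂)` times the coded floor-arch mass of `S_{32T+1,32T+1}` in the window
`[T, 21T]`: the gluing preserves the weight, lands in that window, and has multiplicity `≤ M₁ M₂`
("there are at most `max_k M_k` choices for `γ₁` and at most `max_i M_i` choices for `γ₂`").
[cite: KrachunPanagiotis2026, Lemma 3.3 (proof, the upper bound)] -/
theorem stub_kp_countB : ∀ (T : ℕ), 1 ≤ T → ∀ (M₁ M₂ : ℝ), (∀ k : ℕ, T ≤ k → k < 2 * T → renCap k ≤ M₁) → (∀ i : ℕ, 4 * T ≤ i → i < 5 * T → renCap i ≤ M₂) → ∑ k ∈ Finset.Ico T (2 * T), ∑ P₁ ∈ (rightWalks k).filter (fun P => (renewals k P : ℝ) ≤ renCap k ∧ ¬ GoodHt T (htOf P)), Literature.Probability.RandomPlanarGeometry.SAW.hexCriticalFugacity ^ Literature.Probability.RandomPlanarGeometry.SAW.HV.mwLen P₁ * ∑ i ∈ Finset.Ico (4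 * T) (5 * T), ∑ P₂ ∈ (Literature.Probability.RandomPlanarGeometry.SAW.HV.midWalks (clipV i (htOf P₁))).filter (fun P => Literature.Probability.RandomPlanarGeometry.SAW.HV.IsRightDart i (Literature.Probability.RandomPlanarGeometry.SAW.HV.finalDart P) ∧ (renewals i P : ℝ) ≤ renCap i), Literature.Probability.RandomPlanarGeometry.SAW.hexCriticalFugacity ^ Literature.Probability.RandomPlanarGeometry.SAW.HV.mwLen P₂ * Literature.Probability.RandomPlanarGeometry.SAW.HV.triDr (((htOf P₁ : ℕ) : ℤ) - (Literature.Probability.RandomPlanarGeometry.SAW.HV.finalDart P₂).1.1).toNat ≤ (1 + M₁) * (1 + M₂) * ∑ d ∈ Finset.Icc (T : ℤ) (21 * T), ∑ P ∈ (Literature.Probability.RandomPlanarGeometry.SAW.HV.midWalks (Literature.Probability.RandomPlanarGeometry.SAW.HV.stripV (32 * T + 1) (32 * T + 1))).filter (fun P => Literature.Probability.RandomPlanarGeometry.SAW.HV.finalDart P = ((d, 0, false), (d, -1, true)) ∨ Literature.Probability.RandomPlanarGeometry.SAW.HV.finalDart P = ((d, -1, true), (d, 0, false))), Literature.Probability.RandomPlanarGeometry.SAW.hexCriticalFugacity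 ^ Literature.Probability.RandomPlanarGeometry.SAW.HV.mwLen P := by
  intro T hT M₁ M₂ hM₁ hM₂
  have h0 : (0 : ℝ) ≤ hexCriticalFugacity := hexCriticalFugacity_pos_lt_one.1.le
  have h0₁ : 0 ≤ M₁ := (kpCount_renCap_nonneg T).trans (hM₁ T le_rfl (by omega))
  have h0₂ : 0 ≤ M₂ := (kpCount_renCap_nonneg (4 * T)).trans (hM₂ (4 * T) le_rfl (by omega))
  rw [← cb_sum_eq T, ← sum_biUnion (cb_disjoint T)]
  refine kpCount_sum_le_mul_sum _ ?_ (fun G => hexCriticalFugacity ^ mwLen G)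
    (fun _ _ => pow_nonneg h0 _) (M := (1 + M₁) * (1 + M₂)) fun G _ =>
      (cb_fibre_le hT hM₁ hM₂ G).trans (by nlinarith)
  -- the glued walk is a coded floor arch of the window `[T, 21T]`
  rintro ⟨k, P₁, i, P₂, P₃⟩ ht
  simp only [mem_sigma, mem_filter, mem_Ico] at ht
  obtain ⟨hk, ⟨hP₁, -, -⟩, hi, ⟨hP₂, hR₂, -⟩, hP₃⟩ := ht
  obtain ⟨h1, ⟨d, hd₁, hd₂, hfd⟩, -⟩ := cb_glue hk hi hP₁ hP₂ hR₂ hP₃ rfl rfl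
  simp only [mem_biUnion, mem_Icc, mem_filter]
  exact ⟨d, ⟨hd₁, hd₂⟩, h1, Or.inl hfd⟩

end Summit.CriticalPhenomena.SAWScalingLimit.Theorems.HexConjecture.RootLocality

end
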